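import Summits.Ventures.YMGap.RobustBall.SummableSpecification
import HarnessLib

/-!
# Venture YMGap, track ROBUST-BALL (tier 2) — the one-link perturbation of a SUMMABLE link potential:
# oscillation, cross influence, tails; weighted rows of the influence count

HONEST FRAMING. WHAT THIS IS: a venture file (cell `pub-ymgap`, track Y2 ROBUST-BALL, seat rb-p1), the
one-link bookkeeping of the TIER-2 door on `ℤ^d` (`SummableDoor.lean`). For a link potential `W` with a
summable majorant (`IsLinkSummable W B`, `SummableSpecification.lean`) the one-link perturbation at `e`
is the series `V_ω(g) = ∑'_{X ∋ e} W_X(ω^{e←g})`; this file proves what the robust one-link lemma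
(`RobustOneLink.lean`) needs of it: its OSCILLATION in `g` is at most the summable oscillation load
`a ≥ ∑'_{X ∋ e} osc X e` (`tsum_through_update_osc`); its CROSS INFLUENCE under a change of one other
link `y` is at most `ℓ(e, y) ‖ω_y - η_y‖_F` with the summable cross coefficient
`ℓ(e, y) = ∑'_{X ∋ e, y} lip X y` (`abs_tsum_through_update_sub_le`); its TAIL: boundary conditions
agreeing on the links of finitely many sets `S` move it by at most twice the majorant tail off `S`
(`abs_tsum_through_update_sub_le_tail`, `exists_finset_tail_lt`) — the quasilocality input; and it is
continuous (`continuous_tsum_through`). Wilson side: the links read by a staple are plaquette links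
(`stapleLinks_mem_plaquetteEdges`), so the influence count `n(e, ·)` is finitely supported within
`ℓ^∞`-distance `1` and its WEIGHTED rows are `≤ 6(d-1) · max weight` (`summable_linkInfluence_mul`);
the weighted rows of the tier-2 coefficients `C(e, y) = e^{a} √(c v) |β| n(e, y) + e^{a/2} √c ℓ(e, y)`
are `≤ 6(d-1)|β| e^{a} e^{t} √(c v) + e^{a/2} √c Λ_t` (`summable_coeffS_row`). WHAT IT IS NOT: no
measure theory beyond continuity; no number of the cell; nothing about the continuum.

## References

* H. Föllmer, LNM 1362 (1988), Ch. I, (2.4) (quasilocality), (2.7), (2.20) (sitewise coefficients).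
* H.-O. Georgii, *Gibbs Measures and Phase Transitions* (2011), (2.11), Example 8.9 (summable norms).
-/

noncomputable section

open MeasureTheory Filter Function ProbabilityTheory Real Topology
open scoped NNReal
open Literature.Probability.LatticeModels
open Literature.Probability.LatticeModels.DobrushinMetric
open Literature.MathematicalPhysics.QuantumLattice
open Literature.MathematicalPhysics.QuantumFieldTheory hiding ZdEdge

namespace Summit.Ventures.YMGap.RobustBall

variable {d N : ℕ}

/-! ### The one-link perturbation `V_ω(g) = ∑'_{X ∋ e} W_X(ω^{e←g})`: oscillation, cross influence, tails -/

section OneLink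

variable {G : Type*} {W : Potential (ZdEdge d) G} {B : Finset (ZdEdge d) → ℝ}

/-- The family of terms through `e` is summable (dominated by the link majorant). -/
theorem IsLinkSummable.summable_through (h : IsLinkSummable W B) (e : ZdEdge d) (U : LGConfig d G) :
    Summable fun X : Finset (ZdEdge d) => (if e ∈ X then W X U else 0) :=
  Summable.of_norm_bounded (h.summable e) fun X => by
    rw [Real.norm_eq_abs]
    split_ifs
    · exact h.abs_le X U
    · simp

/-- **Oscillation of the one-link perturbation**: with oscillation witnesses `osc X e` of the terms in
the link `e`, summable through `e` with sum `≤ a`, `V_ω(g) - V_ω(g') ≤ a`. -/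
theorem tsum_through_update_osc (h : IsLinkSummable W B) {osc : Finset (ZdEdge d) → ZdEdge d → ℝ}
    (hosc : ∀ X, Dobrushin.IsOscBound (W X) (osc X)) (e : ZdEdge d)
    (hoscs : Summable fun X : Finset (ZdEdge d) => (if e ∈ X then osc X e else 0)) {a : ℝ}
    (ha : ∑' X : Finset (ZdEdge d), (if e ∈ X then osc X e else 0) ≤ a) (ω : LGConfig d G) (g g' : G) :
    (∑' X : Finset (ZdEdge d), (if e ∈ X then W X (Function.update ω e g) else 0)) ≤
      (∑' X : Finset (ZdEdge d), (if e ∈ X then W X (Function.update ω e g') else 0)) + a := by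
  have hs1 := h.summable_through e (Function.update ω e g)
  have hs2 := h.summable_through e (Function.update ω e g')
  have hdiff : (∑' X : Finset (ZdEdge d), (if e ∈ X then W X (Function.update ω e g) else 0)) -
      (∑' X : Finset (ZdEdge d), (if e ∈ X then W X (Function.update ω e g') else 0)) ≤ a := by
    rw [← hs1.tsum_sub hs2]
    refine le_trans ((hs1.sub hs2).tsum_le_tsum (fun X => ?_) hoscs) ha
    split_ifs with hX
    · have hb := (hosc X).le e (Function.update ω e g) (Function.update ω e g') fun z hz => by
        rw [Function.update_of_ne hz, Function.update_of_ne hz]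
      linarith [(abs_le.1 hb).2]
    · simp
  linarith

/-- **Cross influence of the one-link perturbation**: with Lipschitz witnesses `lip X` and the summable
cross coefficient `ℓ(e, y) = ∑'_{X ∋ e, y} lip X y`, for `ω = η` off `y ≠ e`:
`|V_ω(g) - V_η(g)| ≤ ℓ(e, y) ‖ω_y - η_y‖_F`. -/
theorem abs_tsum_through_update_sub_le (h : IsLinkSummable W B) (hWdep : ∀ X, DependsOn (W X) (↑X : Set (ZdEdge d)))
    {r : G → G → ℝ} {lip : Finset (ZdEdge d) → ZdEdge d → ℝ}
    (hlip : ∀ X, IsLipBound r (W X) (lip X)) {e y : ZdEdge d} (hye : y ≠ e)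
    (hlips : Summable fun X : Finset (ZdEdge d) => (if e ∈ X ∧ y ∈ X then lip X y else 0))
    {ω η : LGConfig d G} (hωη : ∀ z, z ≠ y → ω z = η z) (g : G) :
    |(∑' X : Finset (ZdEdge d), (if e ∈ X then W X (Function.update ω e g) else 0)) -
        ∑' X : Finset (ZdEdge d), (if e ∈ X then W X (Function.update η e g) else 0)| ≤
      (∑' X : Finset (ZdEdge d), (if e ∈ X ∧ y ∈ X then lip X y else 0)) * r (ω y) (η y) := by
  have hs1 := h.summable_through e (Function.update ω e g)
  have hs2 := h.summable_through e (Function.update η e g)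
  have hupd : ∀ z, z ≠ y → Function.update ω e g z = Function.update η e g z := fun z hz => by
    by_cases hze : z = e
    · subst hze; simp
    · rw [Function.update_of_ne hze, Function.update_of_ne hze]; exact hωη z hz
  have hterm : ∀ X : Finset (ZdEdge d),
      |(if e ∈ X then W X (Function.update ω e g) else 0) - (if e ∈ X then W X (Function.update η e g) else 0)| ≤
        (if e ∈ X ∧ y ∈ X then lip X y else 0) * r (ω y) (η y) := by
    intro X
    by_cases heX : e ∈ X
    · by_cases hyX : y ∈ X
      · rw [if_pos heX, if_pos heX, if_pos ⟨heX, hyX⟩]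
        have hb := (hlip X).le y (Function.update ω e g) (Function.update η e g) hupd
        rwa [Function.update_of_ne hye, Function.update_of_ne hye] at hb
      · rw [if_pos heX, if_pos heX, if_neg (fun h => hyX h.2), zero_mul]
        rw [hWdep X (fun z hz => hupd z (fun hzy => hyX (hzy ▸ Finset.mem_coe.1 hz))), sub_self, abs_zero]
    · rw [if_neg heX, if_neg heX, if_neg (fun h => heX h.1), sub_self, abs_zero, zero_mul]
  rw [← hs1.tsum_sub hs2]
  have hsm : Summable fun X : Finset (ZdEdge d) => (if e ∈ X ∧ y ∈ X then lip X y else 0) * r (ω y) (η y) :=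
    hlips.mul_right _
  calc |∑' X, ((if e ∈ X then W X (Function.update ω e g) else 0) -
          (if e ∈ X then W X (Function.update η e g) else 0))|
      ≤ ∑' X, |(if e ∈ X then W X (Function.update ω e g) else 0) -
          (if e ∈ X then W X (Function.update η e g) else 0)| := by
        have := norm_tsum_le_tsum_norm ((hs1.sub hs2).norm)
        simpa only [Real.norm_eq_abs] using this
    _ ≤ ∑' X, (if e ∈ X ∧ y ∈ X then lip X y else 0) * r (ω y) (η y) :=
        (hs1.sub hs2).abs.tsum_le_tsum hterm hsm
    _ = (∑' X, (if e ∈ X ∧ y ∈ X then lip X y else 0)) * r (ω y) (η y) := tsum_mul_right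

/-- **Tails: quasilocality of the one-link perturbation**: if `ω = η` on a finite link set `Λ`
containing every link of the sets in the finite family `S`, then
`|V_ω(g) - V_η(g)| ≤ 2 ∑'_X 𝟙[X ∉ S] 𝟙[e ∈ X] B_X` (the terms in `S` cancel, the others are bounded
by the majorant). -/
theorem abs_tsum_through_update_sub_le_tail (h : IsLinkSummable W B)
    (hWdep : ∀ X, DependsOn (W X) (↑X : Set (ZdEdge d))) (e : ZdEdge d) (S : Finset (Finset (ZdEdge d)))
    {Λ : Finset (ZdEdge d)} (hΛ : ∀ X ∈ S, ∀ z ∈ X, z ≠ e → z ∈ Λ) {ω η : LGConfig d G}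
    (hωη : ∀ z ∈ Λ, ω z = η z) (g : G) :
    |(∑' X : Finset (ZdEdge d), (if e ∈ X then W X (Function.update ω e g) else 0)) -
        ∑' X : Finset (ZdEdge d), (if e ∈ X then W X (Function.update η e g) else 0)| ≤
      2 * ∑' X : Finset (ZdEdge d), (if X ∈ S then 0 else (if e ∈ X then B X else 0)) := by
  have hs1 := h.summable_through e (Function.update ω e g)
  have hs2 := h.summable_through e (Function.update η e g)
  have hB0 : ∀ X, 0 ≤ B X := fun X => h.nonneg X (Function.update ω e g)
  have htail : Summable fun X : Finset (ZdEdge d) => (if X ∈ S then 0 else (if e ∈ X then B X else 0)) :=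
    Summable.of_nonneg_of_le (fun X => by split_ifs <;> first | exact le_rfl | exact hB0 X)
      (fun X => by split_ifs <;> first | exact le_rfl | exact hB0 X) (h.summable e)
  have hterm : ∀ X : Finset (ZdEdge d),
      |(if e ∈ X then W X (Function.update ω e g) else 0) - (if e ∈ X then W X (Function.update η e g) else 0)| ≤
        2 * (if X ∈ S then 0 else (if e ∈ X then B X else 0)) := by
    intro X
    by_cases heX : e ∈ X
    · rw [if_pos heX, if_pos heX]
      by_cases hXS : X ∈ S
      · rw [if_pos hXS, mul_zero]
        rw [hWdep X (fun z hz => ?_), sub_self, abs_zero]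
        by_cases hze : z = e
        · subst hze; simp
        · rw [Function.update_of_ne hze, Function.update_of_ne hze]
          exact hωη z (hΛ X hXS z (Finset.mem_coe.1 hz) hze)
      · rw [if_neg hXS, if_pos heX]
        calc _ ≤ |W X (Function.update ω e g)| + |W X (Function.update η e g)| := abs_sub _ _
          _ ≤ B X + B X := add_le_add (h.abs_le X _) (h.abs_le X _)
          _ = 2 * B X := by ring
    · rw [if_neg heX, if_neg heX, sub_self, abs_zero, if_neg heX]
      split_ifs <;> norm_num
  rw [← hs1.tsum_sub hs2]
  calc |∑' X, ((if e ∈ X then W X (Function.update ω e g) else 0) -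
          (if e ∈ X then W X (Function.update η e g) else 0))|
      ≤ ∑' X, |(if e ∈ X then W X (Function.update ω e g) else 0) -
          (if e ∈ X then W X (Function.update η e g) else 0)| := by
        have := norm_tsum_le_tsum_norm ((hs1.sub hs2).norm)
        simpa only [Real.norm_eq_abs] using this
    _ ≤ ∑' X, 2 * (if X ∈ S then 0 else (if e ∈ X then B X else 0)) :=
        (hs1.sub hs2).abs.tsum_le_tsum hterm (htail.mul_left 2)
    _ = 2 * ∑' X, (if X ∈ S then 0 else (if e ∈ X then B X else 0)) := tsum_mul_left

/-- **Small tails**: for a summable nonnegative family and `ε > 0` there is a finite set of indices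
outside which the sum is `< ε`. -/
theorem exists_finset_tail_lt {ι : Type*} [DecidableEq ι] {f : ι → ℝ} (hf : Summable f) (hf0 : ∀ i, 0 ≤ f i)
    {ε : ℝ} (hε : 0 < ε) : ∃ S : Finset ι, ∑' i, (if i ∈ S then 0 else f i) < ε := by
  have hlim : Tendsto (fun S : Finset ι => ∑ i ∈ S, f i) atTop (𝓝 (∑' i, f i)) := hf.hasSum
  have hev := (hlim.eventually (eventually_gt_nhds (show (∑' i, f i) - ε < ∑' i, f i by linarith)))
  obtain ⟨S, hS⟩ := hev.exists
  refine ⟨S, ?_⟩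
  have hind : Summable fun i => if i ∈ S then f i else 0 :=
    summable_of_ne_finset_zero (s := S) fun i hi => if_neg hi
  have htail : Summable fun i => if i ∈ S then 0 else f i :=
    Summable.of_nonneg_of_le (fun i => by split_ifs <;> first | exact le_rfl | exact hf0 i)
      (fun i => by split_ifs <;> first | exact hf0 i | exact le_rfl) hf
  have hsplit : (∑' i, f i) = (∑ i ∈ S, f i) + ∑' i, (if i ∈ S then 0 else f i) := by
    have hpt : ∀ i, f i = (if i ∈ S then f i else 0) + (if i ∈ S then 0 else f i) := fun i => by
      split_ifs <;> simp
    rw [tsum_congr hpt, hind.tsum_add htail, tsum_eq_sum (s := S) (fun i hi => if_neg hi)]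
    congr 1
    exact Finset.sum_congr rfl fun i hi => if_pos hi
  linarith

end OneLink

/-- The one-link perturbation `U ↦ ∑'_{X ∋ e} W_X(U)` is continuous (Weierstrass M-test). -/
theorem continuous_tsum_through {G : Type*} [TopologicalSpace G] {W : Potential (ZdEdge d) G}
    {B : Finset (ZdEdge d) → ℝ} (h : IsLinkSummable W B) (hWc : ∀ X, Continuous (W X)) (e : ZdEdge d) :
    Continuous fun U : LGConfig d G => ∑' X : Finset (ZdEdge d), (if e ∈ X then W X U else 0) := by
  refine continuous_tsum (fun X => ?_) (h.summable e) fun X U => ?_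
  · by_cases hX : e ∈ X
    · simp only [if_pos hX]; exact hWc X
    · simp only [if_neg hX]; exact continuous_const
  · rw [Real.norm_eq_abs]
    split_ifs
    · exact h.abs_le X U
    · simp

/-! ### The Wilson part: links read by the staples, rows of the influence count -/

/-- The links read by a staple of the plaquette `p` are links of `p`. -/
theorem stapleLinks_mem_plaquetteEdges (p : ZdPlaquette d) (x : ZdEdge d) (k : Fin 3) :
    stapleLinks p x k ∈ plaquetteEdges p := by
  rw [plaquetteEdges_eq]
  unfold stapleLinks
  split_ifs <;> fin_cases k <;> simp

/-- A link with nonzero influence count `n(e, y)` is a link of a plaquette through `e`, hence at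
`ℓ^∞`-distance `≤ 1` from `e`. -/
theorem norm_sub_le_one_of_linkInfluence_ne_zero {e y : ZdEdge d} (h : linkInfluence e y ≠ 0) :
    ‖e.1 - y.1‖ ≤ (1 : ℝ) := by
  unfold linkInfluence at h
  obtain ⟨p, hp, hne⟩ := Finset.exists_ne_zero_of_sum_ne_zero h
  obtain ⟨k, -, hk⟩ := Finset.exists_ne_zero_of_sum_ne_zero hne
  have hy : stapleLinks p e k = y := by
    by_contra hky
    exact hk (if_neg hky)
  exact hy ▸ norm_sub_le_one_of_mem_plaquetteEdges (mem_plaquettesTouching_singleton.1 hp)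
    (stapleLinks_mem_plaquetteEdges p e k)

/-- **Weighted rows of the influence count**: for a weight `0 ≤ w` with `w(y) ≤ M` whenever
`‖e - y‖_∞ ≤ 1`, the family `n(e, y) w(y)` is finitely supported and `∑'_y n(e, y) w(y) ≤ 6(d-1) M`
(`sum_linkInfluence_le_of_subset`). -/
theorem summable_linkInfluence_mul (hd : 1 ≤ d) (e : ZdEdge d) {w : ZdEdge d → ℝ} {M : ℝ}
    (hw0 : ∀ y, 0 ≤ w y) (hwM : ∀ y, ‖e.1 - y.1‖ ≤ (1 : ℝ) → w y ≤ M) :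
    (Summable fun y => (linkInfluence e y : ℝ) * w y) ∧
      ∑' y, (linkInfluence e y : ℝ) * w y ≤ 6 * ((d : ℝ) - 1) * M := by
  classical
  set T : Finset (ZdEdge d) := ((plaquettesTouching {e}) ×ˢ (Finset.univ : Finset (Fin 3))).image
    fun pk => stapleLinks pk.1 e pk.2 with hT
  have hzero : ∀ y ∉ T, (linkInfluence e y : ℝ) * w y = 0 := by
    intro y hy
    have h0 : linkInfluence e y = 0 := by
      unfold linkInfluence
      refine Finset.sum_eq_zero fun p hp => Finset.sum_eq_zero fun k _ => if_neg fun hky => hy ?_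
      exact Finset.mem_image.2 ⟨(p, k), Finset.mem_product.2 ⟨hp, Finset.mem_univ _⟩, hky⟩
    rw [h0, Nat.cast_zero, zero_mul]
  have hM : 0 ≤ M := (hw0 e).trans (hwM e (by simp))
  refine ⟨summable_of_ne_finset_zero hzero, ?_⟩
  rw [tsum_eq_sum hzero]
  have hsumT : ((∑ y ∈ T, linkInfluence e y : ℕ) : ℝ) ≤ 6 * ((d : ℝ) - 1) := by
    calc ((∑ y ∈ T, linkInfluence e y : ℕ) : ℝ) ≤ ((6 * (d - 1) : ℕ) : ℝ) := by
          exact_mod_cast sum_linkInfluence_le_of_subset e T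
      _ = 6 * ((d : ℝ) - 1) := by push_cast [Nat.cast_sub hd]; ring
  calc ∑ y ∈ T, (linkInfluence e y : ℝ) * w y ≤ ∑ y ∈ T, (linkInfluence e y : ℝ) * M := by
        refine Finset.sum_le_sum fun y _ => ?_
        by_cases hn : linkInfluence e y = 0
        · rw [hn, Nat.cast_zero, zero_mul, zero_mul]
        · exact mul_le_mul_of_nonneg_left (hwM y (norm_sub_le_one_of_linkInfluence_ne_zero hn))
            (Nat.cast_nonneg _)
    _ = ((∑ y ∈ T, linkInfluence e y : ℕ) : ℝ) * M := by rw [Nat.cast_sum, Finset.sum_mul]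
    _ ≤ 6 * ((d : ℝ) - 1) * M := mul_le_mul_of_nonneg_right hsumT hM

/-- **The summable influence rows of the tier-2 door, weighted**: with
`C(e, y) = e^{a} √(c v) |β| n(e, y) + e^{a/2} √c ℓ(e, y)` and the weight `e^{t ‖e - y‖_∞}` (`t ≥ 0`),
if `∑'_y ℓ(e, y) e^{t ‖e - y‖_∞} ≤ Λ_t` then the weighted row is summable with sum
`≤ 6(d-1)|β| e^{a} e^{t} √(c v) + e^{a/2} √c Λ_t` — a bound on NUMBERS, not on `W`. -/
theorem summable_coeffS_row (hd : 1 ≤ d) {β c v a Λt t : ℝ} {ℓ : ZdEdge d → ZdEdge d → ℝ}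
    (ht : 0 ≤ t) (hℓs : ∀ e, Summable fun y => ℓ e y * exp (t * ‖e.1 - y.1‖))
    (hℓt : ∀ e, ∑' y, ℓ e y * exp (t * ‖e.1 - y.1‖) ≤ Λt) (e : ZdEdge d) :
    (Summable fun y => (exp a * Real.sqrt (c * v) * |β| * linkInfluence e y +
        exp (a / 2) * Real.sqrt c * ℓ e y) * exp (t * ‖e.1 - y.1‖)) ∧
      ∑' y, (exp a * Real.sqrt (c * v) * |β| * linkInfluence e y + exp (a / 2) * Real.sqrt c * ℓ e y) *
          exp (t * ‖e.1 - y.1‖) ≤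
        6 * ((d : ℝ) - 1) * |β| * (exp a * exp t * Real.sqrt (c * v)) + exp (a / 2) * Real.sqrt c * Λt := by
  obtain ⟨hn, hnle⟩ := summable_linkInfluence_mul hd e (w := fun y => exp (t * ‖e.1 - y.1‖)) (M := exp t)
    (fun y => (exp_pos _).le) (fun y hy => exp_le_exp.2 (by nlinarith))
  have heq : (fun y => (exp a * Real.sqrt (c * v) * |β| * linkInfluence e y +
      exp (a / 2) * Real.sqrt c * ℓ e y) * exp (t * ‖e.1 - y.1‖)) =
      fun y => exp a * Real.sqrt (c * v) * |β| * ((linkInfluence e y : ℝ) * exp (t * ‖e.1 - y.1‖)) +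
        exp (a / 2) * Real.sqrt c * (ℓ e y * exp (t * ‖e.1 - y.1‖)) := funext fun y => by ring
  rw [heq]
  refine ⟨(hn.mul_left _).add ((hℓs e).mul_left _), ?_⟩
  rw [(hn.mul_left _).tsum_add ((hℓs e).mul_left _), tsum_mul_left, tsum_mul_left]
  have h1 : exp a * Real.sqrt (c * v) * |β| * ∑' y, (linkInfluence e y : ℝ) * exp (t * ‖e.1 - y.1‖) ≤
      exp a * Real.sqrt (c * v) * |β| * (6 * ((d : ℝ) - 1) * exp t) :=
    mul_le_mul_of_nonneg_left hnle (by positivity)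
  have h2 : exp (a / 2) * Real.sqrt c * ∑' y, ℓ e y * exp (t * ‖e.1 - y.1‖) ≤
      exp (a / 2) * Real.sqrt c * Λt := mul_le_mul_of_nonneg_left (hℓt e) (by positivity)
  calc _ ≤ exp a * Real.sqrt (c * v) * |β| * (6 * ((d : ℝ) - 1) * exp t) + exp (a / 2) * Real.sqrt c * Λt :=
        add_le_add h1 h2
    _ = _ := by ring

end Summit.Ventures.YMGap.RobustBall
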